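import Mathlib
import Summits.Ventures.PercRepro2.SwAllMarkStepJunctions
import Summits.Ventures.PercRepro2.SwOutJunctionH1GTypedEdge

/-!
# THE GENERAL MARK STEP, VIII: one (H1) junction, without or with the edge `h–u` (blind cell
PercRepro2, night-4 g33, 2026-08-28; proofs/NIGHT4-G33.md §5)

With the (H1) single-junction theorem on the general doubly typed side
(`gTypedSwAll_of_junctionH1`, SwOutJunctionH1GTyped) the general mark step settles g14's (H1)
class of the isolated graph: **`swAll_markStep_of_junctionH1`** — a vertex `u ∉ {l, h, x}` without
loop, not adjacent to `h`, satisfying (H1) in `{l}ᶜ` of the isolated graph `G − x` (every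
neighbour of `u` joined to `h` or in a component of `(G − x)[{l, h, u}ᶜ]` without a neighbour of
`h`), every other vertex joined to `l` or hanging on the mark.  On the pattern `d` the exempt set
is the UNIQUE red neighbour of the mark when there is one (forced into `C_R(l)` by `markU`), and
`X = {x}` — the mark carries loops only in the isolated graph.  **`swAll_markStep_of_junctionH1_edge`**:
the same with `u` joined to `h` by exactly one edge `e₀` (g29's class B13 of the isolated graph,
through `gTypedSwAll_of_junctionH1_edge`).
-/

namespace Summit.Ventures.PercRepro2

namespace LocRows

open Hull

variable {V : Type*} {E : Type*} [Fintype E] [DecidableEq E]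

open scoped Classical

variable {ends : E → Sym2 V} {x l h : V}

omit [Fintype E] [DecidableEq E] in
/-- The isolated graph has no loop at a vertex `u ≠ x` without loop. -/
lemma isolate_hloop_u {u : V} (hux : u ≠ x) (hloop : ∀ e, ends e ≠ s(u, u)) :
    ∀ e, isolate ends x e ≠ s(u, u) := by
  intro e he
  by_cases hxe : x ∈ ends e
  · rw [isolate_apply_of_mem hxe, Sym2.eq_iff] at he
    rcases he with ⟨h', -⟩ | ⟨h', -⟩ <;> exact hux h'.symm
  · rw [isolate_apply_of_notMem hxe] at he
    exact hloop e he

omit [Fintype E] [DecidableEq E] in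
/-- Two vertices other than `x` not adjacent in the graph are not adjacent in the isolated
graph. -/
lemma isolate_hnadj {u : V} (hxh : x ≠ h) (hnadj : ∀ e, ends e ≠ s(h, u)) :
    ∀ e, isolate ends x e ≠ s(h, u) := by
  intro e he
  by_cases hxe : x ∈ ends e
  · rw [isolate_apply_of_mem hxe, Sym2.eq_iff] at he
    rcases he with ⟨h', -⟩ | ⟨-, h'⟩ <;> exact hxh h'
  · rw [isolate_apply_of_notMem hxe] at he
    exact hnadj e he

omit [Fintype E] [DecidableEq E] in
/-- The mark carries loops only in the isolated graph. -/
lemma isolate_selfLoops : ∀ e, x ∈ isolate ends x e → isolate ends x e = s(x, x) := by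
  intro e hxe
  by_cases hx : x ∈ ends e
  · exact isolate_apply_of_mem hx
  · rw [isolate_apply_of_notMem hx] at hxe
    exact absurd hxe hx

/-- **THE GENERAL MARK STEP WITH ONE (H1) JUNCTION** (g14's class of the isolated graph): `u ∉
{l, h, x}` without loop, not adjacent to `h`, (H1) in `{l}ᶜ` of the isolated graph; every other
vertex joined to `l` or hanging on the mark. -/
theorem swAll_markStep_of_junctionH1 (hlh : l ≠ h) (hloop : ∀ e, ends e ≠ s(h, h))
    (hxl : x ≠ l) (hxh : x ≠ h) {u : V} (hul : u ≠ l) (huh : u ≠ h) (hux : u ≠ x)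
    (hloop_u : ∀ e, ends e ≠ s(u, u)) (hnadj : ∀ e, ends e ≠ s(h, u))
    (hH1 : H1 (isolate ends x) ({l}ᶜ) h u)
    (hout : ∀ y, y ≠ l → y ≠ h → y ≠ x → y ≠ u →
      (∃ e, ends e = s(y, l)) ∨ (∀ e, y ∈ ends e → x ∈ ends e)) : SwAll ends l h x := by
  refine swAll_of_gTyped_patterns hxl hxh fun d _ => ?_
  refine gTypedSwAll_of_junctionH1
    (F := fun y => y ∈ openNbrs ends d x ∧ ∀ z ∈ openNbrs ends d x, z = y) (u := u)
    hlh hul.symm huh.symm (isolate_hloop hxh hloop) (isolate_hloop_u hux hloop_u)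
    (isolate_hnadj hxh hnadj) hH1 (isUpperSet_markU d x) (isLowerSet_markD d x)
    (isLowerSet_markD'' d x) isUpperSet_univ ?_ ?_ ?_ ?_ ?_
  · -- the unique red neighbour is forced into `C_R(l)`
    rintro y ⟨-, huniq⟩ S ⟨z, hz, hzS⟩
    rw [← huniq z hz]
    exact hzS
  · exact fun h' => hxh (Set.mem_singleton_iff.1 h').symm
  · exact fun h' => hux (Set.mem_singleton_iff.1 h')
  · intro y hy _ e hye
    rw [Set.mem_singleton_iff] at hy
    subst hy
    exact isolate_selfLoops e hye
  · intro y hyl hyh hyu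
    by_cases hyx : y = x
    · exact Or.inr (Or.inl (by rw [hyx]; exact Set.mem_singleton _))
    by_cases hyF : y ∈ openNbrs ends d x ∧ ∀ z ∈ openNbrs ends d x, z = y
    · exact Or.inl hyF
    rcases hout y hyl hyh hyx hyu with ⟨e, he⟩ | hiso
    · exact Or.inr (Or.inr (Or.inl ⟨e, isolate_eq_of_ends_eq hyx hxl.symm he⟩))
    · exact Or.inr (Or.inr (Or.inr (isolate_iso hyx hiso)))

/-- **Row (SW) from the general mark step with one (H1) junction.** -/
theorem sw_markStep_of_junctionH1 (hlh : l ≠ h) (hloop : ∀ e, ends e ≠ s(h, h))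
    (hxl : x ≠ l) (hxh : x ≠ h) {u : V} (hul : u ≠ l) (huh : u ≠ h) (hux : u ≠ x)
    (hloop_u : ∀ e, ends e ≠ s(u, u)) (hnadj : ∀ e, ends e ≠ s(h, u))
    (hH1 : H1 (isolate ends x) ({l}ᶜ) h u)
    (hout : ∀ y, y ≠ l → y ≠ h → y ≠ x → y ≠ u →
      (∃ e, ends e = s(y, l)) ∨ (∀ e, y ∈ ends e → x ∈ ends e)) : Sw ends l h x :=
  sw_of_swAll ends
    (swAll_markStep_of_junctionH1 hlh hloop hxl hxh hul huh hux hloop_u hnadj hH1 hout)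

omit [Fintype E] [DecidableEq E] in
/-- An edge of the graph avoiding `x` is the same edge of the isolated graph, and it is the only
edge with these ends there if it was in the graph. -/
lemma isolate_huniq {u : V} {e₀ : E} (hxh : x ≠ h) (hux : u ≠ x) (he₀ : ends e₀ = s(h, u))
    (huniq : ∀ e, ends e = s(h, u) → e = e₀) :
    isolate ends x e₀ = s(h, u) ∧ ∀ e, isolate ends x e = s(h, u) → e = e₀ := by
  refine ⟨isolate_eq_of_ends_eq hxh.symm hux he₀, fun e he => ?_⟩
  by_cases hxe : x ∈ ends e
  · rw [isolate_apply_of_mem hxe, Sym2.eq_iff] at he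
    rcases he with ⟨h', -⟩ | ⟨-, h'⟩ <;> exact absurd h' hxh
  · rw [isolate_apply_of_notMem hxe] at he
    exact huniq e he

/-- **THE GENERAL MARK STEP WITH ONE (H1) JUNCTION JOINED TO `h` BY A SINGLE EDGE** (g29's class
of the isolated graph): `u ∉ {l, h, x}` without loop, `e₀` the only edge `h–u`, (H1) in `{l}ᶜ` of
the isolated graph; every other vertex joined to `l` or hanging on the mark. -/
theorem swAll_markStep_of_junctionH1_edge (hlh : l ≠ h) (hloop : ∀ e, ends e ≠ s(h, h))
    (hxl : x ≠ l) (hxh : x ≠ h) {u : V} (hul : u ≠ l) (huh : u ≠ h) (hux : u ≠ x)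
    (hloop_u : ∀ e, ends e ≠ s(u, u)) {e₀ : E} (he₀ : ends e₀ = s(h, u))
    (huniq : ∀ e, ends e = s(h, u) → e = e₀) (hH1 : H1 (isolate ends x) ({l}ᶜ) h u)
    (hout : ∀ y, y ≠ l → y ≠ h → y ≠ x → y ≠ u →
      (∃ e, ends e = s(y, l)) ∨ (∀ e, y ∈ ends e → x ∈ ends e)) : SwAll ends l h x := by
  obtain ⟨he₀', huniq'⟩ := isolate_huniq hxh hux he₀ huniq
  refine swAll_of_gTyped_patterns hxl hxh fun d _ => ?_
  refine gTypedSwAll_of_junctionH1_edge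
    (F := fun y => y ∈ openNbrs ends d x ∧ ∀ z ∈ openNbrs ends d x, z = y) (u := u) (e₀ := e₀)
    hlh hul.symm huh.symm (isolate_hloop hxh hloop) (isolate_hloop_u hux hloop_u) he₀' huniq'
    hH1 (isUpperSet_markU d x) (isLowerSet_markD d x) (isLowerSet_markD'' d x) isUpperSet_univ
    ?_ ?_ ?_ ?_ ?_
  · rintro y ⟨-, huniq⟩ S ⟨z, hz, hzS⟩
    rw [← huniq z hz]
    exact hzS
  · exact fun h' => hxh (Set.mem_singleton_iff.1 h').symm
  · exact fun h' => hux (Set.mem_singleton_iff.1 h')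
  · intro y hy _ e hye
    rw [Set.mem_singleton_iff] at hy
    subst hy
    exact isolate_selfLoops e hye
  · intro y hyl hyh hyu
    by_cases hyx : y = x
    · exact Or.inr (Or.inl (by rw [hyx]; exact Set.mem_singleton _))
    by_cases hyF : y ∈ openNbrs ends d x ∧ ∀ z ∈ openNbrs ends d x, z = y
    · exact Or.inl hyF
    rcases hout y hyl hyh hyx hyu with ⟨e, he⟩ | hiso
    · exact Or.inr (Or.inr (Or.inl ⟨e, isolate_eq_of_ends_eq hyx hxl.symm he⟩))
    · exact Or.inr (Or.inr (Or.inr (isolate_iso hyx hiso)))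

/-- **Row (SW) from the general mark step with one (H1) junction joined to `h` by a single
edge.** -/
theorem sw_markStep_of_junctionH1_edge (hlh : l ≠ h) (hloop : ∀ e, ends e ≠ s(h, h))
    (hxl : x ≠ l) (hxh : x ≠ h) {u : V} (hul : u ≠ l) (huh : u ≠ h) (hux : u ≠ x)
    (hloop_u : ∀ e, ends e ≠ s(u, u)) {e₀ : E} (he₀ : ends e₀ = s(h, u))
    (huniq : ∀ e, ends e = s(h, u) → e = e₀) (hH1 : H1 (isolate ends x) ({l}ᶜ) h u)
    (hout : ∀ y, y ≠ l → y ≠ h → y ≠ x → y ≠ u →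
      (∃ e, ends e = s(y, l)) ∨ (∀ e, y ∈ ends e → x ∈ ends e)) : Sw ends l h x :=
  sw_of_swAll ends
    (swAll_markStep_of_junctionH1_edge hlh hloop hxl hxh hul huh hux hloop_u he₀ huniq hH1 hout)

end LocRows

end Summit.Ventures.PercRepro2
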